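import Mathlib
import Summits.RiemannHypothesis.RiemannHypothesis.Theorems.SignConeConeMagnificationPoissonDigamma
import Literature.Analysis.Complex.HarnackHalfPlane
import Literature.Analysis.SpecialFunctions.DigammaLogBound
import Literature.Analysis.SpecialFunctions.EulerMascheroniBounds
import Literature.Analysis.SpecialFunctions.LogPiBounds

/-!
# Crux `SignCone.ConeMagnification` (stmt-RiemannHypothesis-16303), line `Sketch` r8:
# the trivial type inequality with room, `C₁ ≤ 0.49 < 1/2`, from the Carathéodory majorant by HARNACK

The comb programme's first prediction (COMB-EVALUATION §5(a), the 2001 "trivial design" `α = δ₁`) is the type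
inequality `C₁ := Σ_n (c(n) − Λ(n))/n ≤ 1/2` for every unit-slack weight.  In terms of the continuation
`F = L_c − 1/(s−1)` (landed `stub_continuation`/`stub_cara`), `C₁ = F(1) + γ`, and the Carathéodory majorant
`Re F(s) ≤ 𝒫(s) := ½ + Re(1/s) + ½ Re ψ(s/2) − ½ log π` (`stub_cara`, p133591, Poisson form ⟺ digamma form by the
bridge `poissonArch_eq_half_re_digamma`, p134552) at the point `s = 1` only gives `F(1) + γ ≤ ½ + ξ'/ξ(1) = 0.523…`.

THIS FILE proves `F(1) + γ ≤ 0.49` by a three-line potential-theoretic argument, with no combs: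
`h := 𝒫 − Re F ≥ 0` is harmonic on `Re s > 1/2` (`= Im` of the holomorphic `i(𝒫_hol − F)`), and

* `h(5) ≥ 0.586`: `𝒫(5)` is explicit (`ψ(5/2) = ψ(1/2) + 2 + 2/3`), while `Re F(5) = L_c(5) − 1/4` and, since `c ≥ 0`
  lives on `n ≥ 2`, `L_c(5) ≤ L_c(2)/8 ≤ (1 + 𝒫(2))/8` (Cara at `s = 2`);
* Harnack's inequality on the disc `B(5, 4.499)` (`Complex.im_apply_ge_harnack`, in the tree):
  `h(1) ≥ h(5)·(R − 4)/(R + 4) ≥ 0.034 > ξ'/ξ(1) = 0.0231`;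
* hence `F(1) = 𝒫(1) − h(1) ≤ 𝒫(1) − 0.034`, i.e. `F(1) + γ ≤ 0.4887 ≤ 0.49`.

Main results: `TrivialDesign.re_apply_one_add_euler_le` (for any Carathéodory description `F` of a weight
`c ≥ 0`, `c 1 = 0`, `Σ c n^{-σ} < ∞ (σ > 1)`: `Re F(1) + γ ≤ 49/100`) and the registered anchor
`trivialDesignHarnack`.  So the constant `1/2` of the trivial type inequality is NOT attained by any admissible weight.
-/

noncomputable section

-- `Summit.RiemannHypothesis.RiemannHypothesis.…` repeats a namespace component by design (D-0017 layout).
set_option linter.dupNamespace false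

open scoped BigOperators Topology
open Complex Set Filter Metric

namespace Summit.RiemannHypothesis.RiemannHypothesis.Theorems.SignConeConeMagnification

namespace TrivialDesign

/-! ### Real Dirichlet series at real points -/

/-- For real `c` and real `σ`, the `n`-th `L`-series term has real part `c(n)/n^σ` (both `0` at `n = 0`). [folklore] -/
theorem re_term (c : ℕ → ℝ) (σ : ℝ) (hσ : σ ≠ 0) (n : ℕ) :
    (LSeries.term (fun n => ((c n : ℝ) : ℂ)) (σ : ℂ) n).re = c n / (n : ℝ) ^ σ := by
  rcases Nat.eq_zero_or_pos n with rfl | hn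
  · simp [LSeries.term_zero, Real.zero_rpow hσ]
  · rw [LSeries.term_of_ne_zero hn.ne']
    have h : ((n : ℂ) ^ (σ : ℂ)) = (((n : ℝ) ^ σ : ℝ) : ℂ) := by
      rw [Complex.ofReal_cpow (Nat.cast_nonneg n)]
      simp
    rw [h, ← Complex.ofReal_div, Complex.ofReal_re]

/-- For real `c ≥ 0`… no sign needed: for real `c` and real `σ > 1` with `Σ c n^{-σ}` summable,
`Re L_c(σ) = Σ' c(n)/n^σ` and the real series is summable. [folklore] -/
theorem re_LSeries_ofReal (c : ℕ → ℝ) {σ : ℝ} (hσ : 1 < σ)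
    (hsum : LSeriesSummable (fun n => ((c n : ℝ) : ℂ)) σ) :
    (LSeries (fun n => ((c n : ℝ) : ℂ)) σ).re = ∑' n : ℕ, c n / (n : ℝ) ^ σ ∧
      Summable (fun n : ℕ => c n / (n : ℝ) ^ σ) := by
  have hσ0 : σ ≠ 0 := by linarith
  have hs : Summable (fun n => LSeries.term (fun n => ((c n : ℝ) : ℂ)) (σ : ℂ) n) := hsum
  have hre := Complex.re_tsum hs
  refine ⟨?_, ?_⟩
  · rw [LSeries, hre]
    exact tsum_congr fun n => re_term c σ hσ0 n
  · have := (Complex.reCLM.summable hs)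
    refine this.congr fun n => ?_
    simp only [Complex.reCLM_apply]
    exact re_term c σ hσ0 n

/-- **`L_c(5) ≤ L_c(2)/8`** for `c ≥ 0` with `c(1) = 0` (the series lives on `n ≥ 2`, where `n^{-5} ≤ n^{-2}/8`).
[folklore] -/
theorem re_LSeries_five_le (c : ℕ → ℝ) (hc0 : ∀ n, 0 ≤ c n) (hc1 : c 1 = 0)
    (hsum : ∀ σ : ℝ, 1 < σ → LSeriesSummable (fun n => ((c n : ℝ) : ℂ)) σ) :
    (LSeries (fun n => ((c n : ℝ) : ℂ)) 5).re ≤ (LSeries (fun n => ((c n : ℝ) : ℂ)) 2).re / 8 := by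
  obtain ⟨h5, hs5⟩ := re_LSeries_ofReal c (by norm_num : (1 : ℝ) < 5) (hsum 5 (by norm_num))
  obtain ⟨h2, hs2⟩ := re_LSeries_ofReal c (by norm_num : (1 : ℝ) < 2) (hsum 2 (by norm_num))
  have e5 : ((5 : ℝ) : ℂ) = 5 := by norm_num
  have e2 : ((2 : ℝ) : ℂ) = 2 := by norm_num
  rw [e5] at h5
  rw [e2] at h2
  rw [h5, h2, ← tsum_div_const]
  refine Summable.tsum_le_tsum (fun n => ?_) hs5 (hs2.div_const 8)
  rcases Nat.lt_or_ge n 2 with hn | hn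
  · interval_cases n
    · simp [Real.zero_rpow (by norm_num : (5 : ℝ) ≠ 0), Real.zero_rpow (by norm_num : (2 : ℝ) ≠ 0)]
    · simp [hc1]
  · have hnR : (2 : ℝ) ≤ n := by exact_mod_cast hn
    have hn0 : (0 : ℝ) < n := by linarith
    have hpow : (n : ℝ) ^ (5 : ℝ) = (n : ℝ) ^ (2 : ℝ) * (n : ℝ) ^ (3 : ℝ) := by
      rw [← Real.rpow_add hn0]; norm_num
    have h3 : (8 : ℝ) ≤ (n : ℝ) ^ (3 : ℝ) := by
      have : (n : ℝ) ^ (3 : ℝ) = (n : ℝ) ^ (3 : ℕ) := by exact_mod_cast Real.rpow_natCast (n : ℝ) 3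
      rw [this]; nlinarith
    have h2pos : 0 < (n : ℝ) ^ (2 : ℝ) := Real.rpow_pos_of_pos hn0 _
    rw [hpow, ← div_div]
    have hq : 0 ≤ c n / (n : ℝ) ^ (2 : ℝ) := div_nonneg (hc0 n) h2pos.le
    exact div_le_div_of_nonneg_left hq (by norm_num) h3

/-! ### The holomorphic majorant and the positive harmonic function -/

/-- `ψ(5/2) = ψ(1/2) + 2 + 2/3`. [folklore] -/
theorem digamma_five_halves : Complex.digamma (5 / 2) = -2 * Complex.log 2 - Real.eulerMascheroniConstant + 2 + 2 / 3 := by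
  have h1 : Complex.digamma (1 / 2 + 1) = Complex.digamma (1 / 2) + (1 / 2 : ℂ)⁻¹ :=
    Complex.digamma_apply_add_one _ fun m h => by
      have := congrArg Complex.re h
      simp at this
      linarith [(Nat.cast_nonneg m : (0 : ℝ) ≤ m)]
  have h2 : Complex.digamma (3 / 2 + 1) = Complex.digamma (3 / 2) + (3 / 2 : ℂ)⁻¹ :=
    Complex.digamma_apply_add_one _ fun m h => by
      have := congrArg Complex.re h
      simp at this
      linarith [(Nat.cast_nonneg m : (0 : ℝ) ≤ m)]
  have e1 : (1 / 2 : ℂ) + 1 = 3 / 2 := by norm_num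
  have e2 : (3 / 2 : ℂ) + 1 = 5 / 2 := by norm_num
  rw [e1] at h1
  rw [e2] at h2
  rw [h2, h1, Complex.digamma_one_half]
  norm_num

/-- `Re log 2 = log 2` (complex vs real logarithm). [folklore] -/
theorem re_clog_two : (Complex.log 2).re = Real.log 2 := by
  rw [Complex.log_re]
  norm_num

/-- **The trivial type inequality with room.**  Let `c ≥ 0`, `c(1) = 0`, `Σ c(n) n^{-σ} < ∞` (`σ > 1`), and let `F` be
holomorphic on `Re s > 1/2` with `F = L_c − 1/(s−1)` on `Re s > 1` and the Carathéodory majorant (Poisson form, as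
produced by `stub_cara`) `Re F(s) ≤ ½ + Re(1/s) + (1/2π)∫ Re ψ(¼ + iv/2) P_{σ−½}(t − v) dv − ½ log π` on `Re s > 1/2`.
Then `Re F(1) + γ ≤ 49/100`; in particular the 2001 constant `C₁ = F(1) + γ` of the trivial design is `< 1/2`.
Proof: Harnack's inequality on `B(5, 4.499)` for the holomorphic `i(𝒫_hol + ε − F)` (`Im > 0`), with
`h(5) ≥ 𝒫(5) + 1/4 − (1 + 𝒫(2))/8` (`L_c(5) ≤ L_c(2)/8`, Cara at `2`) and the digamma values `ψ(1/2)`, `ψ(1)`,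
`ψ(5/2)`. [folklore] -/
theorem re_apply_one_add_euler_le (c : ℕ → ℝ) (hc0 : ∀ n, 0 ≤ c n) (hc1 : c 1 = 0)
    (hsum : ∀ σ : ℝ, 1 < σ → LSeriesSummable (fun n => ((c n : ℝ) : ℂ)) σ)
    (F : ℂ → ℂ) (hFd : DifferentiableOn ℂ F {s : ℂ | 1 / 2 < s.re})
    (hFeq : ∀ s : ℂ, 1 < s.re → F s = LSeries (fun n => ((c n : ℝ) : ℂ)) s - 1 / (s - 1))
    (hFle : ∀ s : ℂ, 1 / 2 < s.re →
      (F s).re ≤ 1 / 2 + (1 / s).re +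
        1 / (2 * Real.pi) * (∫ v : ℝ, (Complex.digamma (1 / 4 + v / 2 * Complex.I)).re *
          ((s.re - 1 / 2) / ((s.re - 1 / 2) ^ 2 + (s.im - v) ^ 2))) - Real.log Real.pi / 2) :
    (F 1).re + Real.eulerMascheroniConstant ≤ 49 / 100 := by
  -- the majorant in digamma form
  have hmaj : ∀ s : ℂ, 1 / 2 < s.re →
      (F s).re ≤ 1 / 2 + (1 / s).re + (Complex.digamma (s / 2)).re / 2 - Real.log Real.pi / 2 := by
    intro s hs
    have h := hFle s hs
    rwa [poissonArch_eq_half_re_digamma hs] at h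
  -- the holomorphic majorant `P` and its real part
  set P : ℂ → ℂ := fun s => 1 / 2 + 1 / s + Complex.digamma (s / 2) / 2 - (Real.log Real.pi / 2 : ℝ) with hP
  have hPre : ∀ s : ℂ, (P s).re = 1 / 2 + (1 / s).re + (Complex.digamma (s / 2)).re / 2 - Real.log Real.pi / 2 := by
    intro s
    simp only [hP, Complex.add_re, Complex.sub_re, Complex.ofReal_re, Complex.div_ofNat_re]
    norm_num
  have hPd : DifferentiableOn ℂ P {s : ℂ | 1 / 2 < s.re} := by
    have hdig : DifferentiableOn ℂ (fun s : ℂ => Complex.digamma (s / 2)) {s : ℂ | 1 / 2 < s.re} := by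
      refine Literature.Analysis.SpecialFunctions.Complex.differentiableOn_digamma.comp
        (by fun_prop : Differentiable ℂ fun s : ℂ => s / 2).differentiableOn fun s hs => ?_
      simp only [Set.mem_setOf_eq, Complex.div_ofNat_re] at hs ⊢
      linarith
    have hinv : DifferentiableOn ℂ (fun s : ℂ => 1 / s) {s : ℂ | 1 / 2 < s.re} :=
      DifferentiableOn.div (differentiableOn_const _) differentiableOn_id fun s hs h0 => by
        simp only [Set.mem_setOf_eq, h0, Complex.zero_re] at hs
        linarith
    simp only [hP]
    exact (((differentiableOn_const _).add hinv).add (hdig.div_const 2)).sub (differentiableOn_const _)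
  -- `Q = i (P - F + ε)` has positive imaginary part on `Re s > 1/2`
  set ε : ℝ := 1 / 10000 with hε
  set Q : ℂ → ℂ := fun s => Complex.I * (P s - F s + (ε : ℂ)) with hQ
  have hQim : ∀ s : ℂ, (Q s).im = (P s).re - (F s).re + ε := by
    intro s
    simp [hQ]
  have hQd : DifferentiableOn ℂ Q {s : ℂ | 1 / 2 < s.re} := by
    simp only [hQ]
    exact (((hPd.sub hFd).add (differentiableOn_const _)).const_mul _)
  have hQpos : ∀ s : ℂ, 1 / 2 < s.re → 0 < (Q s).im := by
    intro s hs
    rw [hQim, hPre]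
    have := hmaj s hs
    rw [hε]
    linarith
  -- Harnack on the disc `B(5, R)`, `R = 4.499`, at the point `1`
  set R : ℝ := 4499 / 1000 with hR
  have hball : ball (5 : ℂ) R ⊆ {s : ℂ | 1 / 2 < s.re} := by
    intro z hz
    rw [mem_ball, dist_eq_norm] at hz
    have h1 : |(z - 5).re| ≤ ‖z - 5‖ := Complex.abs_re_le_norm _
    simp only [Complex.sub_re] at h1
    have h5 : (5 : ℂ).re = 5 := by norm_num
    rw [h5] at h1
    simp only [Set.mem_setOf_eq]
    rw [hR] at hz
    have := (abs_le.1 h1).1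
    linarith
  have h1mem : (1 : ℂ) ∈ ball (5 : ℂ) R := by
    rw [mem_ball, dist_eq_norm, hR]
    norm_num
  have hH := Complex.im_apply_ge_harnack (Q := Q) (c := 5) (by rw [hR]; norm_num : (0 : ℝ) < R)
    (hQd.mono hball) (fun z hz => hQpos z (hball hz)) h1mem
  have hnorm : ‖(1 : ℂ) - 5‖ = 4 := by norm_num
  rw [hnorm] at hH
  -- `Im Q(5) ≥ 𝒫(5) + 1/4 - (1 + 𝒫(2))/8 + ε`
  have hF2 : (F 2).re = (LSeries (fun n => ((c n : ℝ) : ℂ)) 2).re - 1 := by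
    rw [hFeq 2 (by norm_num)]
    norm_num
  have hF5 : (F 5).re = (LSeries (fun n => ((c n : ℝ) : ℂ)) 5).re - 1 / 4 := by
    rw [hFeq 5 (by norm_num)]
    norm_num
  have hmaj2 := hmaj 2 (by norm_num)
  have hmaj5 := re_LSeries_five_le c hc0 hc1 hsum
  have hP2 : (Complex.digamma ((2 : ℂ) / 2)).re = -Real.eulerMascheroniConstant := by
    rw [show (2 : ℂ) / 2 = 1 by norm_num, Complex.digamma_one]
    simp
  have hP5 : (Complex.digamma ((5 : ℂ) / 2)).re = -2 * Real.log 2 - Real.eulerMascheroniConstant + 2 + 2 / 3 := by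
    rw [digamma_five_halves]
    simp [re_clog_two]
  have hP1 : (Complex.digamma ((1 : ℂ) / 2)).re = -2 * Real.log 2 - Real.eulerMascheroniConstant := by
    rw [Complex.digamma_one_half]
    simp [re_clog_two]
  have hinv2 : (1 / (2 : ℂ)).re = 1 / 2 := by norm_num
  have hinv5 : (1 / (5 : ℂ)).re = 1 / 5 := by norm_num
  have hinv1 : (1 / (1 : ℂ)).re = 1 := by norm_num
  have hQ5 : (Q 5).im = 1 / 2 + 1 / 5 + (-2 * Real.log 2 - Real.eulerMascheroniConstant + 2 + 2 / 3) / 2 -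
      Real.log Real.pi / 2 - (F 5).re + ε := by
    rw [hQim, hPre, hinv5, hP5]
  have hQ1 : (Q 1).im = 1 / 2 + 1 + (-2 * Real.log 2 - Real.eulerMascheroniConstant) / 2 -
      Real.log Real.pi / 2 - (F 1).re + ε := by
    rw [hQim, hPre, hinv1, hP1]
  rw [hinv2, hP2] at hmaj2
  -- numerics
  have hl2 := Real.log_two_gt_d9
  have hl2' := Real.log_two_lt_d9
  have hγ := Literature.Analysis.SpecialFunctions.Real.eulerMascheroniConstant_gt_d8
  have hγ' := Literature.Analysis.SpecialFunctions.Real.eulerMascheroniConstant_lt_d8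
  have hπ := Literature.Analysis.SpecialFunctions.Real.log_pi_gt_d20
  have hπ' := Literature.Analysis.SpecialFunctions.Real.log_pi_lt_d20
  have hfac : (R - 4) / (R + 4) = 499 / 8499 := by rw [hR]; norm_num
  rw [hfac, hQ5, hQ1] at hH
  rw [hF5] at hH
  rw [hF2] at hmaj2
  rw [hε] at hH
  nlinarith [hH, hmaj2, hmaj5, hl2, hl2', hγ, hγ', hπ, hπ']

end TrivialDesign

/-- **Anchor `trivialDesignHarnack`** (registered sub-goal): for every weight `c ≥ 0`, `c 1 = 0`, with
`Σ c(n) n^{-σ} < ∞` (`σ > 1`) and a Carathéodory description `F` (the output of `stub_cara`), `Re F(1) + γ ≤ 49/100` —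
the trivial type inequality `C₁ ≤ 1/2` of the comb programme with room, by Harnack's inequality. [folklore] -/
theorem trivialDesignHarnack : ∀ c : ℕ → ℝ, (∀ n, 0 ≤ c n) → c 1 = 0 →
    (∀ σ : ℝ, 1 < σ → LSeriesSummable (fun n => ((c n : ℝ) : ℂ)) σ) →
    ∀ F : ℂ → ℂ, DifferentiableOn ℂ F {s : ℂ | 1 / 2 < s.re} →
      (∀ s : ℂ, 1 < s.re → F s = LSeries (fun n => ((c n : ℝ) : ℂ)) s - 1 / (s - 1)) →
      (∀ s : ℂ, 1 / 2 < s.re →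
        (F s).re ≤ 1 / 2 + (1 / s).re +
          1 / (2 * Real.pi) * (∫ v : ℝ, (Complex.digamma (1 / 4 + v / 2 * Complex.I)).re *
            ((s.re - 1 / 2) / ((s.re - 1 / 2) ^ 2 + (s.im - v) ^ 2))) - Real.log Real.pi / 2) →
      (F 1).re + Real.eulerMascheroniConstant ≤ 49 / 100 :=
  fun c hc0 hc1 hsum F hFd hFeq hFle => TrivialDesign.re_apply_one_add_euler_le c hc0 hc1 hsum F hFd hFeq hFle

end Summit.RiemannHypothesis.RiemannHypothesis.Theorems.SignConeConeMagnification

end
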